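import Literature.NumberTheory.Transcendental.PadicNewtonInterpolation
import HarnessLib

/-!
# The ultrametric Schwarz lemma with multiplicities and small jets; Taylor coefficients

Everything in this file is **proved**; there are no definitions. Sequel to
`PadicNewtonInterpolation.lean` (weighted coefficient bounds `WtBdd ρ B b`, divided differences
`dd`, `ddList`, Newton's formula `tsum_eq_newtonSum_add`).

* `norm_newtonSum_le` — the Newton sum is small when the Newton coefficients are;
* `norm_gdd_le` — if the JETS of `G_b = ∑ bₙ zⁿ` at the points of a finite `δ`-separated set are
  small, `‖G_b^{(k)}(a)/k!‖ ≤ ε` for `k < T` (jets written as `G_{ddList (replicate k a) b}(a)`, see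
  `tsum_eq_taylor` / `taylor_coeff_unique` below), then every generalised divided difference over
  these nodes using each node at most `T` times is `≤ ε δ^{-t}` (`t` = its order);
* `norm_tsum_le_max_of_small_jets` — the **small-jets Schwarz lemma**: under the same
  hypothesis, for `‖z‖ ≤ r ≤ 1` (`r < ρ`) and any node sequence `xs` of length `N` using each node
  at most `T` times, `‖G_b(z)‖ ≤ max (ε δ^{-(N-1)}) (B ρ^{-N} ∏_{x ∈ xs} ‖z − x‖)`. With exact zeros
  (`ε = 0`) and every node repeated `T` times this is the ultrametric Schwarz lemma with
  multiplicities on the disc of radius `ρ`, `‖G_b(z)‖ ≤ B ∏_a (‖z − a‖/ρ)^T;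
* `tsum_eq_taylor`, `taylor_coeff_unique` — **Taylor's formula** with remainder (repeating a node
  `k` times gives the Taylor coefficient) and the **uniqueness of Taylor coefficients** on a
  punctured disc, by which the jets of an explicitly expanded function (an exponential sum, say)
  are identified with the divided differences above.

This is the non-archimedean counterpart of the Hermite-interpolation bound
`Literature.NumberTheory.Transcendental.Hermite.norm_le_of_small_jets`
(`HermiteInterpolationBound.lean`) used by the tree's Cijsouw–Waldschmidt 1977 files: in the
`p`-adic theory of linear forms in logarithms the auxiliary function has only approximately
vanishing jets (the linear form is small, not zero), the nodes `s/2^J`, `s ∈ ℕ`, cluster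
`p`-adically (so the conditioning `δ^{-N}` matters), and the radius is `ρ = p^{(p-2)/(p-1)} > 1 ≥ r`
(a saving of `((p-2)/(p-1)) log p` per zero counted with multiplicity).

## References
* A. M. Robert, *A Course in `p`-adic Analysis*, GTM 198 (2000), Ch. 6 §2.
* Kunrui Yu, *Linear forms in p-adic logarithms II*, Compositio Math. 74 (1990), 15–113, §3.
-/

noncomputable section

open Filter Topology IsUltrametricDist Finset

namespace Literature.NumberTheory.Transcendental

namespace PadicNewton

variable {K : Type*} [NontriviallyNormedField K] [IsUltrametricDist K] [CompleteSpace K]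

/-! ### Bounding the Newton sum -/

omit [IsUltrametricDist K] [CompleteSpace K] in
/-- Norm of a product over a list. [folklore] -/
private theorem norm_list_prod_map_sub (z : K) (xs : List K) :
    ‖(xs.map fun x ↦ z - x).prod‖ = (xs.map fun x ↦ ‖z - x‖).prod := by
  induction xs with
  | nil => simp
  | cons x xs ih => simp [List.map_cons, List.prod_cons, norm_mul, ih]

omit [CompleteSpace K] in
/-- `‖x − y‖ ≤ max ‖x‖ ‖y‖` (ultrametric). [folklore] -/
private theorem norm_sub_le_max' (x y : K) : ‖x - y‖ ≤ max ‖x‖ ‖y‖ := by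
  simpa only [sub_eq_add_neg, norm_neg] using IsUltrametricDist.norm_add_le_max x (-y)

omit [CompleteSpace K] in
/-- **Bound for the Newton sum**: if every Newton coefficient `G_{b⁽ⁱ⁾}(xᵢ)` (`b⁽ⁱ⁾ = ddList` of the
first `i` nodes) is `≤ ε δ^{-i}` with `0 < δ ≤ 1`, and `‖z − xᵢ‖ ≤ 1`, then
`‖newtonSum xs b z‖ ≤ ε δ^{-(|xs|-1)}`. [cite: Yu1990, Lemma 1.2] [cite: Yu1989, Lemma 1.4] -/
theorem norm_newtonSum_le {δ : ℝ} (hδ0 : 0 < δ) (hδ1 : δ ≤ 1) :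
    ∀ (xs : List K) {b : ℕ → K} {ε : ℝ}, 0 ≤ ε →
      (∀ (pre : List K) (x : K) (post : List K), xs = pre ++ x :: post →
        ‖∑' n, ddList pre b n * x ^ n‖ ≤ ε * δ⁻¹ ^ pre.length) →
      ∀ {z : K}, (∀ x ∈ xs, ‖z - x‖ ≤ 1) → ‖newtonSum xs b z‖ ≤ ε * δ⁻¹ ^ (xs.length - 1) := by
  have hδi : 1 ≤ δ⁻¹ := (one_le_inv₀ hδ0).mpr hδ1
  intro xs
  induction xs with
  | nil =>
    intro b ε hε _ z _
    simpa using hε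
  | cons x xs ih =>
    intro b ε hε H z hz
    have h0 : ‖∑' n, b n * x ^ n‖ ≤ ε := by
      simpa using H [] x xs (by simp)
    have H' : ∀ (pre : List K) (x' : K) (post : List K), xs = pre ++ x' :: post →
        ‖∑' n, ddList pre (dd x b) n * x' ^ n‖ ≤ ε * δ⁻¹ * δ⁻¹ ^ pre.length := by
      intro pre x' post hxs
      have := H (x :: pre) x' post (by simp [hxs])
      rw [ddList_cons, List.length_cons, pow_succ'] at this
      linarith [this]
    have h1 := ih (b := dd x b) (ε := ε * δ⁻¹) (by positivity) H'
      (fun y hy ↦ hz y (by simp [hy]))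
    have hzx : ‖z - x‖ ≤ 1 := hz x (by simp)
    rw [newtonSum_cons, List.length_cons, Nat.add_sub_cancel]
    refine (IsUltrametricDist.norm_add_le_max _ _).trans (max_le ?_ ?_)
    · exact h0.trans (le_mul_of_one_le_right hε (one_le_pow₀ hδi))
    · rw [norm_mul]
      rcases eq_or_ne xs [] with hnil | hne
      · subst hnil; simpa using hε
      · have hlen : 1 ≤ xs.length := List.length_pos_iff.mpr hne
        calc ‖z - x‖ * ‖newtonSum xs (dd x b) z‖ ≤ 1 * (ε * δ⁻¹ * δ⁻¹ ^ (xs.length - 1)) :=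
              mul_le_mul hzx h1 (norm_nonneg _) zero_le_one
          _ = ε * δ⁻¹ ^ xs.length := by
              rw [one_mul, mul_assoc, ← pow_succ', Nat.sub_add_cancel hlen]

/-! ### Generalised divided differences with small jets -/

/-- **Small jets give small generalised divided differences.** Let `nodes` be a finite
`δ`-separated set in the disc `‖·‖ ≤ r < ρ` (`0 < δ ≤ 1`), and suppose the jets of `G_b` are small
there: `‖G_{ddList (replicate k a) b}(a)‖ = ‖G_b^{(k)}(a)/k!‖ ≤ ε` for `a ∈ nodes`, `k < T`. Then
for every list `ys` of nodes and node `y` such that `y :: ys` uses each node at most `T` times,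
`‖G_{ddList ys b}(y)‖ ≤ ε δ^{-|ys|}`. (Induction on `|ys|`: if all nodes of `ys` equal `y` this is a
jet; otherwise move a node `x ≠ y` to the end (`ddList_perm`) and use
`G_{dd x g}(y) = (G_g(y) − G_g(x))/(y − x)`.) [cite: Yu1990, Lemma 1.2] [cite: Yu1989, Lemma 1.4] -/
theorem norm_gdd_le [DecidableEq K] {ρ B r δ ε : ℝ} (hρ : 0 < ρ) (hr : r < ρ) {b : ℕ → K}
    (hb : WtBdd ρ B b)
    (nodes : Finset K) (hnod : ∀ a ∈ nodes, ‖a‖ ≤ r) (hδ0 : 0 < δ) (hδ1 : δ ≤ 1)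
    (hsep : ∀ a ∈ nodes, ∀ a' ∈ nodes, a ≠ a' → δ ≤ ‖a - a'‖) {T : ℕ} (hε : 0 ≤ ε)
    (hjet : ∀ a ∈ nodes, ∀ k < T, ‖∑' n, ddList (List.replicate k a) b n * a ^ n‖ ≤ ε) :
    ∀ (ys : List K) (y : K), y ∈ nodes → (∀ x ∈ ys, x ∈ nodes) →
      (∀ a ∈ nodes, (y :: ys).count a ≤ T) →
        ‖∑' n, ddList ys b n * y ^ n‖ ≤ ε * δ⁻¹ ^ ys.length := by
  classical
  have hδi : 1 ≤ δ⁻¹ := (one_le_inv₀ hδ0).mpr hδ1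
  suffices hN : ∀ (N : ℕ) (ys : List K) (y : K), ys.length = N → y ∈ nodes →
      (∀ x ∈ ys, x ∈ nodes) → (∀ a ∈ nodes, (y :: ys).count a ≤ T) →
        ‖∑' n, ddList ys b n * y ^ n‖ ≤ ε * δ⁻¹ ^ ys.length by
    intro ys y; exact hN ys.length ys y rfl
  intro N
  induction N using Nat.strong_induction_on with
  | _ N IH =>
  intro ys y hlen hy hys hcnt
  have hysr : ∀ x ∈ ys, ‖x‖ ≤ r := fun x hx ↦ hnod x (hys x hx)
  by_cases hall : ∀ x ∈ ys, x = y
  · -- a pure jet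
    have hrep : ys = List.replicate ys.length y := List.eq_replicate_iff.mpr ⟨rfl, hall⟩
    have hlt : ys.length < T := by
      have h1 := hcnt y hy
      rw [List.count_cons_self, hrep, List.count_replicate_self] at h1
      omega
    have h2 := hjet y hy ys.length hlt
    rw [← hrep] at h2
    exact h2.trans (le_mul_of_one_le_right hε (one_le_pow₀ hδi))
  · push Not at hall
    obtain ⟨x, hxys, hxy⟩ := hall
    set ys' := ys.erase x with hys'
    have hperm : ys.Perm (ys' ++ [x]) :=
      (List.perm_cons_erase hxys).trans (List.perm_append_singleton x ys').symm
    have hlen' : ys'.length + 1 = ys.length := by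
      rw [hys', List.length_erase_of_mem hxys]
      have : 0 < ys.length := List.length_pos_of_mem hxys
      omega
    have hx : x ∈ nodes := hys x hxys
    have hsub' : ∀ x' ∈ ys', x' ∈ ys := fun x' hx' ↦ List.mem_of_mem_erase hx'
    -- `ddList ys b = dd x (ddList ys' b)`
    have hdd : ddList ys b = dd x (ddList ys' b) := by
      rw [ddList_perm hρ hr hperm hb hysr, ddList_append_singleton]
    set g := ddList ys' b with hg
    have hgB : WtBdd ρ (B / ρ ^ ys'.length) g :=
      wtBdd_ddList hρ hr.le ys' hb (fun x' hx' ↦ hysr x' (hsub' x' hx'))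
    -- the division identity for `g`
    have hdiv := tsum_eq_add_sub_mul_tsum_dd hgB hρ hr (hnod x hx) (hnod y hy)
    have hyx : y - x ≠ 0 := sub_ne_zero.mpr (Ne.symm hxy)
    have hδle : δ ≤ ‖y - x‖ := hsep y hy x hx (Ne.symm hxy)
    have hquot : ∑' n, dd x g n * y ^ n =
        ((∑' n, g n * y ^ n) - ∑' n, g n * x ^ n) / (y - x) := by
      rw [eq_div_iff hyx]
      linear_combination -hdiv
    -- the two inductive bounds
    have hlt : ys'.length < N := by omega
    have IHy : ‖∑' n, g n * y ^ n‖ ≤ ε * δ⁻¹ ^ ys'.length := by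
      refine IH _ hlt ys' y rfl hy (fun x' hx' ↦ hys x' (hsub' x' hx')) fun a ha ↦ ?_
      refine le_trans ?_ (hcnt a ha)
      exact (List.erase_sublist.cons_cons y).count_le a
    have IHx : ‖∑' n, g n * x ^ n‖ ≤ ε * δ⁻¹ ^ ys'.length := by
      refine IH _ hlt ys' x rfl hx (fun x' hx' ↦ hys x' (hsub' x' hx')) fun a ha ↦ ?_
      refine le_trans ?_ (hcnt a ha)
      rw [← (List.perm_cons_erase hxys).count_eq a]
      exact List.count_le_count_cons
    rw [hdd, hquot, norm_div, div_le_iff₀ (lt_of_lt_of_le hδ0 hδle), ← hlen', pow_succ]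
    calc ‖(∑' n, g n * y ^ n) - ∑' n, g n * x ^ n‖
        ≤ max ‖∑' n, g n * y ^ n‖ ‖∑' n, g n * x ^ n‖ := norm_sub_le_max' _ _
      _ ≤ ε * δ⁻¹ ^ ys'.length := max_le IHy IHx
      _ = ε * (δ⁻¹ ^ ys'.length * δ⁻¹) * δ := by field_simp
      _ ≤ ε * (δ⁻¹ ^ ys'.length * δ⁻¹) * ‖y - x‖ := by gcongr

/-! ### The small-jets Schwarz lemma -/

/-- **Ultrametric Schwarz lemma with multiplicities and small jets.** Let `G_b(z) = ∑ bₙ zⁿ` with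
`‖bₙ‖ ρⁿ ≤ B`, let `nodes` be a finite `δ`-separated subset of the disc `‖·‖ ≤ r` (`r < ρ`, `r ≤ 1`,
`0 < δ ≤ 1`) at which the jets of order `< T` are small, `‖G_b^{(k)}(a)/k!‖ ≤ ε`, and let `xs` be
any sequence of nodes using each node at most `T` times (`N = |xs|`). Then for `‖z‖ ≤ r`:
`‖G_b(z)‖ ≤ max (ε δ^{-(N-1)}) (B ρ^{-N} ∏_{x ∈ xs} ‖z − x‖)`.
With exact zeros (`ε = 0`) and `xs` = each node `T` times this is the ultrametric Schwarz lemma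
`‖G_b(z)‖ ≤ B ∏_{a} (‖z − a‖/ρ)^T`. [cite: Yu1990, Lemma 1.2] [cite: Yu1989, Lemma 1.4] -/
theorem norm_tsum_le_max_of_small_jets [DecidableEq K] {ρ B r δ ε : ℝ} (hρ : 0 < ρ) (hr : r < ρ)
    (hr1 : r ≤ 1)
    {b : ℕ → K} (hb : WtBdd ρ B b) (nodes : Finset K) (hnod : ∀ a ∈ nodes, ‖a‖ ≤ r)
    (hδ0 : 0 < δ) (hδ1 : δ ≤ 1) (hsep : ∀ a ∈ nodes, ∀ a' ∈ nodes, a ≠ a' → δ ≤ ‖a - a'‖)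
    {T : ℕ} (hε : 0 ≤ ε)
    (hjet : ∀ a ∈ nodes, ∀ k < T, ‖∑' n, ddList (List.replicate k a) b n * a ^ n‖ ≤ ε)
    (xs : List K) (hxs : ∀ x ∈ xs, x ∈ nodes) (hcnt : ∀ a ∈ nodes, xs.count a ≤ T)
    {z : K} (hz : ‖z‖ ≤ r) :
    ‖∑' n, b n * z ^ n‖ ≤
      max (ε * δ⁻¹ ^ (xs.length - 1)) (B / ρ ^ xs.length * (xs.map fun x ↦ ‖z - x‖).prod) := by
  classical
  have hxsr : ∀ x ∈ xs, ‖x‖ ≤ r := fun x hx ↦ hnod x (hxs x hx)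
  rw [tsum_eq_newtonSum_add hρ hr xs hb hxsr hz]
  refine (IsUltrametricDist.norm_add_le_max _ _).trans (max_le_max ?_ ?_)
  · -- the Newton sum
    refine norm_newtonSum_le hδ0 hδ1 xs hε ?_ fun x hx ↦ ?_
    · intro pre x post hsplit
      have hsub : (pre ++ [x]).Sublist xs := by
        rw [hsplit]; exact (List.Sublist.refl pre).append ((List.nil_sublist post).cons_cons x)
      have hperm : (x :: pre).Perm (pre ++ [x]) := (List.perm_append_singleton x pre).symm
      refine norm_gdd_le hρ hr hb nodes hnod hδ0 hδ1 hsep hε hjet pre x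
        (hxs x (by rw [hsplit]; simp)) (fun y hy ↦ hxs y (by rw [hsplit]; simp [hy])) ?_
      intro a ha
      rw [hperm.count_eq a]
      exact (hsub.count_le a).trans (hcnt a ha)
    · calc ‖z - x‖ ≤ max ‖z‖ ‖x‖ := norm_sub_le_max' z x
        _ ≤ r := max_le hz (hxsr x hx)
        _ ≤ 1 := hr1
  · -- the remainder
    rw [norm_mul, norm_list_prod_map_sub, mul_comm]
    exact mul_le_mul_of_nonneg_right
      ((wtBdd_ddList hρ hr.le xs hb hxsr).norm_tsum_le hρ hr.le hz)
      (List.prod_nonneg fun t ht ↦ by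
        obtain ⟨x, -, rfl⟩ := List.mem_map.mp ht; exact norm_nonneg _)


/-! ### Taylor expansion: repeated nodes give the Taylor coefficients -/

omit [IsUltrametricDist K] [CompleteSpace K] in
/-- The Newton sum along the constant node sequence `a, a, …, a` is the Taylor polynomial
`∑_{k<N} G_{ddList (replicate k a) b}(a) (z − a)^k`.
[cite: Robert2000PadicAnalysis, Ch. 6 §§1–2 (power series on discs, re-expansion at a point)] -/
theorem newtonSum_replicate (a : K) :
    ∀ (N : ℕ) (b : ℕ → K) (z : K), newtonSum (List.replicate N a) b z =
      ∑ k ∈ range N, (∑' n, ddList (List.replicate k a) b n * a ^ n) * (z - a) ^ k := by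
  intro N
  induction N with
  | zero => intro b z; simp
  | succ N ih =>
    intro b z
    rw [List.replicate_succ, newtonSum_cons, ih, Finset.sum_range_succ', Finset.mul_sum]
    simp only [pow_zero, mul_one, List.replicate_succ, ddList_cons]
    rw [add_comm]
    refine congrArg₂ (· + ·) (Finset.sum_congr rfl fun k _ ↦ by ring) rfl

/-- **Taylor's formula with remainder** on the disc: for `‖a‖, ‖z‖ ≤ r < ρ`,
`G_b(z) = ∑_{k<N} G_{ddList (replicate k a) b}(a) (z − a)^k + (z − a)^N G_{ddList (replicate N a) b}(z)`,
and the remainder series satisfies the weighted bound with `B/ρ^N` (`wtBdd_ddList`).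
[cite: Robert2000PadicAnalysis, Ch. 6 §§1–2 (power series on discs, re-expansion at a point)] -/
theorem tsum_eq_taylor {ρ B r : ℝ} (hρ : 0 < ρ) (hr : r < ρ) {b : ℕ → K} (hb : WtBdd ρ B b)
    {a : K} (ha : ‖a‖ ≤ r) {z : K} (hz : ‖z‖ ≤ r) (N : ℕ) :
    ∑' n, b n * z ^ n =
      (∑ k ∈ range N, (∑' n, ddList (List.replicate k a) b n * a ^ n) * (z - a) ^ k) +
        (z - a) ^ N * ∑' n, ddList (List.replicate N a) b n * z ^ n := by
  have h := tsum_eq_newtonSum_add hρ hr (List.replicate N a) hb (fun x hx ↦ by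
    rw [List.eq_of_mem_replicate hx]; exact ha) hz
  rw [h, newtonSum_replicate, List.map_replicate, List.prod_replicate]

/-- **Uniqueness of Taylor coefficients.** If on the punctured disc `‖z‖ ≤ r`, `z ≠ a` (`r > 0`)
`G_b(z) = ∑_{k<N} c_k (z − a)^k + (z − a)^N h(z)` with `h` bounded on the disc, then
`c_k = G_{ddList (replicate k a) b}(a)` (`= G_b^{(k)}(a)/k!`) for all `k < N`. This is how the
jets of an explicitly expanded function (e.g. an exponential sum) are identified with the divided
differences used in `norm_tsum_le_max_of_small_jets`.
[cite: Robert2000PadicAnalysis, Ch. 6 §§1–2 (power series on discs, re-expansion at a point)] -/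
theorem taylor_coeff_unique {ρ r M : ℝ} (hρ : 0 < ρ) (hr : r < ρ) (hr0 : 0 < r) {a : K}
    (ha : ‖a‖ ≤ r) :
    ∀ (N : ℕ) {B' : ℝ} {b : ℕ → K}, WtBdd ρ B' b → ∀ (c : ℕ → K) (h : K → K),
      (∀ z, ‖z‖ ≤ r → ‖h z‖ ≤ M) →
      (∀ z, ‖z‖ ≤ r → z ≠ a →
        ∑' n, b n * z ^ n = (∑ k ∈ range N, c k * (z - a) ^ k) + (z - a) ^ N * h z) →
      ∀ k < N, c k = ∑' n, ddList (List.replicate k a) b n * a ^ n := by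
  intro N
  induction N with
  | zero => intro B' b _ c h _ _ k hk; exact absurd hk (Nat.not_lt_zero k)
  | succ N ih =>
    intro B' b hb c h hh hid
    have hM : 0 ≤ M := (norm_nonneg _).trans (hh a ha)
    have hB0 : 0 ≤ B' := hb.nonneg
    -- the function `w` with `G_b(z) − c 0 = (z − a) w(z)` on the punctured disc
    set w : K → K := fun z ↦ (∑ k ∈ range N, c (k + 1) * (z - a) ^ k) + (z - a) ^ N * h z
      with hw
    have hid' : ∀ z, ‖z‖ ≤ r → z ≠ a → (∑' n, b n * z ^ n) - c 0 = (z - a) * w z := by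
      intro z hz hza
      rw [hid z hz hza, Finset.sum_range_succ', hw]
      simp only [pow_zero, mul_one, pow_succ]
      rw [mul_add, Finset.mul_sum]
      have : ∀ k ∈ range N, (z - a) * (c (k + 1) * (z - a) ^ k) =
          c (k + 1) * ((z - a) ^ k * (z - a)) := fun k _ ↦ by ring
      rw [Finset.sum_congr rfl this]
      ring
    -- a uniform bound for `w` on the disc
    set W : ℝ := (∑ k ∈ range N, ‖c (k + 1)‖ * r ^ k) + r ^ N * M with hW
    have hW0 : 0 ≤ W := by
      have h1 : 0 ≤ ∑ k ∈ range N, ‖c (k + 1)‖ * r ^ k :=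
        Finset.sum_nonneg fun k _ ↦ mul_nonneg (norm_nonneg _) (pow_nonneg hr0.le k)
      have h2 : 0 ≤ r ^ N * M := mul_nonneg (pow_nonneg hr0.le N) hM
      linarith
    have hza_le : ∀ z, ‖z‖ ≤ r → ‖z - a‖ ≤ r := fun z hz ↦
      (norm_sub_le_max' z a).trans (max_le hz ha)
    have hwle : ∀ z, ‖z‖ ≤ r → ‖w z‖ ≤ W := by
      intro z hz
      have hza := hza_le z hz
      refine (norm_add_le _ _).trans (add_le_add ?_ ?_)
      · refine (norm_sum_le _ _).trans (Finset.sum_le_sum fun k _ ↦ ?_)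
        rw [norm_mul, norm_pow]
        exact mul_le_mul_of_nonneg_left (pow_le_pow_left₀ (norm_nonneg _) hza k) (norm_nonneg _)
      · rw [norm_mul, norm_pow]
        exact mul_le_mul (pow_le_pow_left₀ (norm_nonneg _) hza N) (hh z hz) (norm_nonneg _)
          (pow_nonneg (hr0.le) N)
    -- step 1: `c 0 = G_b(a)`
    have hc0 : c 0 = ∑' n, b n * a ^ n := by
      have key : ∀ z, ‖z‖ ≤ r → z ≠ a →
          ‖(∑' n, b n * a ^ n) - c 0‖ ≤ ‖z - a‖ * (B' / ρ + W) := by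
        intro z hz hza
        have h1 : ‖(∑' n, b n * z ^ n) - ∑' n, b n * a ^ n‖ ≤ ‖z - a‖ * (B' / ρ) :=
          norm_tsum_sub_tsum_le hb hρ hr ha hz
        have h2 : ‖(∑' n, b n * z ^ n) - c 0‖ ≤ ‖z - a‖ * W := by
          rw [hid' z hz hza, norm_mul]
          exact mul_le_mul_of_nonneg_left (hwle z hz) (norm_nonneg _)
        calc ‖(∑' n, b n * a ^ n) - c 0‖
            = ‖((∑' n, b n * z ^ n) - c 0) - ((∑' n, b n * z ^ n) - ∑' n, b n * a ^ n)‖ := by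
              congr 1; ring
          _ ≤ ‖(∑' n, b n * z ^ n) - c 0‖ + ‖(∑' n, b n * z ^ n) - ∑' n, b n * a ^ n‖ :=
              norm_sub_le _ _
          _ ≤ ‖z - a‖ * W + ‖z - a‖ * (B' / ρ) := add_le_add h2 h1
          _ = ‖z - a‖ * (B' / ρ + W) := by ring
      symm
      rw [← sub_eq_zero, ← norm_le_zero_iff]
      set C := B' / ρ + W with hC
      have hC0 : 0 ≤ C := by positivity
      refine le_of_forall_pos_le_add fun η hη ↦ ?_
      rw [zero_add]
      obtain ⟨t, ht0, ht⟩ := NormedField.exists_norm_lt K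
        (lt_min hr0 (div_pos hη (by positivity : (0 : ℝ) < C + 1)))
      have htr : ‖t‖ < r := lt_of_lt_of_le ht (min_le_left _ _)
      have htη : ‖t‖ < η / (C + 1) := lt_of_lt_of_le ht (min_le_right _ _)
      have hz : ‖a + t‖ ≤ r := (IsUltrametricDist.norm_add_le_max a t).trans (max_le ha htr.le)
      have hza : a + t ≠ a := by
        intro h'; apply ht0.ne'; rw [show t = 0 from by simpa using h', norm_zero]
      calc ‖(∑' n, b n * a ^ n) - c 0‖ ≤ ‖a + t - a‖ * C := key (a + t) hz hza
        _ = ‖t‖ * C := by rw [add_sub_cancel_left]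
        _ ≤ η / (C + 1) * C := mul_le_mul_of_nonneg_right htη.le hC0
        _ ≤ η := by
            rw [div_mul_eq_mul_div, div_le_iff₀ (by positivity)]
            nlinarith
    -- step 2: the shifted identity for `dd a b`
    have hid2 : ∀ z, ‖z‖ ≤ r → z ≠ a →
        ∑' n, dd a b n * z ^ n = (∑ k ∈ range N, c (k + 1) * (z - a) ^ k) + (z - a) ^ N * h z := by
      intro z hz hza
      have hdiv := tsum_eq_add_sub_mul_tsum_dd hb hρ hr ha hz
      have hne : z - a ≠ 0 := sub_ne_zero.mpr hza
      have h3 := hid' z hz hza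
      rw [← hc0] at hdiv
      have : (z - a) * ∑' n, dd a b n * z ^ n = (z - a) * w z := by
        rw [← h3, hdiv]; ring
      exact mul_left_cancel₀ hne this
    have ih' := ih (wtBdd_dd hb hρ hr.le ha) (fun k ↦ c (k + 1)) h hh hid2
    intro k hk
    rcases k with _ | k
    · simpa using hc0
    · have := ih' k (by omega)
      rw [this, List.replicate_succ, ddList_cons]

end PadicNewton

end Literature.NumberTheory.Transcendental

end
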